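import Summits.ABC.ABC.Theses.FeketeScales
import Literature.NumberTheory.DiophantineGeometry.AbcQualityProofs

/-!
# `SparseGoodScales` (stmt-ABC-2161): every scale `30 ≤ R < 7^12` is bad at exponent `1`

Negative support lemma for the crux `Summit.ABC.ABC.Theses.FeketeScales.SparseGoodScales`
(cdisprove seat, cycle 1): an EXPLICIT covering chain for the `δ = 0` instance, complementing the
asymptotic `Negative/EveryScale.lean` (whose threshold `N(1)` is astronomically large).  Ten abc triples
(nine of shape `(1, b, b+1)`, plus `(3, 125, 128)`) — found by the greedy search `compute/cover_job.py` (kit job j017836 continues the same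
certificate to `10^300`; the first and third links are swapped for `(3,125,128)` and `(1,4374,4375)`, which
reach further) — have shadows `[rad, c)` covering `[30, 7^{12})`:

| scale range `[F, c)`        | triple `(1, b, c)`                  | `rad(b·c)`     |
|-----------------------------|-------------------------------------|----------------|
| `[30, 128)`                 | `(3, 5^3, 2^7)`                     | `30`           |
| `[128, 243)`                | `b = 2·11²`, `c = 3^5`              | `66`           |
| `[243, 4375)`               | `b = 2·3^7`, `c = 5^4·7`            | `210`          |
| `[4375, 9801)`              | `b = 2^3·5²·7²`, `c = 3^4·11²`      | `2310`         |
| `[9801, 59049)`             | `b = 2^3·11²·61`, `c = 3^{10}`      | `4026`         |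
| `[59049, 688128)`           | `b = 11^4·47`, `c = 2^{15}·3·7`     | `21714`        |
| `[688128, 5764801)`         | `b = 2^6·3·5²·1201`, `c = 7^8`      | `252210`       |
| `[5764801, 76545001)`       | `b = 2^3·3^7·5^4·7`, `c = 13²·673²` | `1837290`      |
| `[76545001, 1003290625)`    | `b = 2^{16}·3^7·7`, `c = 5^5·321053`| `67421130`     |
| `[1003290625, 13841287201)` | `b = 2^5·3²·5²·13·19·43·181`, `c = 7^{12}` | `403704210` |

So `exists_triple_straddle : 30 ≤ R → R < 7^12 → ∃ abc triple, rad ≤ R ∧ R < c`; below `30` the scales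
`R ∈ [9, 29]` are in fact good at exponent `1` (`G(R) = 9`, complete hit enumeration to `10^6`, not
formalised), and `R ∈ [6, 8]` are bad again (`(1,8,9)`).
-/

noncomputable section

namespace Summit.ABC.ABC.Theorems.SparseGoodScales.Negative

open Literature.NumberTheory.DiophantineGeometry UniqueFactorizationMonoid

/-- `IsRelPrime` of concrete naturals from `Nat.Coprime` (for `radical_mul`). [folklore] -/
theorem isRelPrime_of_coprime {a b : ℕ} (h : Nat.Coprime a b) : IsRelPrime a b :=
  Nat.coprime_iff_isRelPrime.mp h

/-- `rad(3·125·128) = 3·5·2 = 30`. [folklore] -/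
theorem rad_v1 : rad 3 125 128 = 30 := by
  rw [rad_def, show (3 * 125 * 128 : ℕ) = (3 * 5 ^ 3) * 2 ^ 7 by norm_num,
    radical_mul (isRelPrime_of_coprime (by norm_num)),
    radical_mul (isRelPrime_of_coprime (by norm_num)),
    radical_pow _ (by norm_num), radical_pow _ (by norm_num),
    radical_eq_self_of_prime (by norm_num), radical_eq_self_of_prime (by norm_num),
    radical_eq_self_of_prime (by norm_num)]
  all_goals norm_num

/-- `rad(1·4374·4375) = 2·3·5·7 = 210`. [folklore] -/
theorem rad_v3 : rad 1 4374 4375 = 210 := by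
  rw [rad_def, show (1 * 4374 * 4375 : ℕ) = ((2 * 3 ^ 7) * 5 ^ 4) * 7 by norm_num,
    radical_mul (isRelPrime_of_coprime (by norm_num)),
    radical_mul (isRelPrime_of_coprime (by norm_num)),
    radical_mul (isRelPrime_of_coprime (by norm_num)),
    radical_pow _ (by norm_num), radical_pow _ (by norm_num),
    radical_eq_self_of_prime (by norm_num), radical_eq_self_of_prime (by norm_num),
    radical_eq_self_of_prime (by norm_num), radical_eq_self_of_prime (by norm_num)]
  all_goals norm_num

/-- `rad(1·242·243) = 2·11·3 = 66`. [folklore] -/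
theorem rad_w2 : rad 1 242 243 = 66 := by
  rw [rad_def, show (1 * 242 * 243 : ℕ) = (2 * 11 ^ 2) * 3 ^ 5 by norm_num,
    radical_mul (isRelPrime_of_coprime (by norm_num)),
    radical_mul (isRelPrime_of_coprime (by norm_num)),
    radical_pow _ (by norm_num), radical_pow _ (by norm_num),
    radical_eq_self_of_prime (by norm_num), radical_eq_self_of_prime (by norm_num),
    radical_eq_self_of_prime (by norm_num)]
  all_goals norm_num

/-- `rad(1·9800·9801) = 2·5·7·3·11 = 2310`. [folklore] -/
theorem rad_w4 : rad 1 9800 9801 = 2310 := by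
  rw [rad_def, show (1 * 9800 * 9801 : ℕ) = (((2 ^ 3 * 5 ^ 2) * 7 ^ 2) * 3 ^ 4) * 11 ^ 2 by norm_num,
    radical_mul (isRelPrime_of_coprime (by norm_num)),
    radical_mul (isRelPrime_of_coprime (by norm_num)),
    radical_mul (isRelPrime_of_coprime (by norm_num)),
    radical_mul (isRelPrime_of_coprime (by norm_num)),
    radical_pow _ (by norm_num), radical_pow _ (by norm_num), radical_pow _ (by norm_num),
    radical_pow _ (by norm_num), radical_pow _ (by norm_num),
    radical_eq_self_of_prime (by norm_num), radical_eq_self_of_prime (by norm_num),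
    radical_eq_self_of_prime (by norm_num), radical_eq_self_of_prime (by norm_num),
    radical_eq_self_of_prime (by norm_num)]
  all_goals norm_num

/-- `rad(1·59048·59049) = 2·11·61·3 = 4026`. [folklore] -/
theorem rad_w5 : rad 1 59048 59049 = 4026 := by
  rw [rad_def, show (1 * 59048 * 59049 : ℕ) = ((2 ^ 3 * 11 ^ 2) * 61) * 3 ^ 10 by norm_num,
    radical_mul (isRelPrime_of_coprime (by norm_num)),
    radical_mul (isRelPrime_of_coprime (by norm_num)),
    radical_mul (isRelPrime_of_coprime (by norm_num)),
    radical_pow _ (by norm_num), radical_pow _ (by norm_num), radical_pow _ (by norm_num),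
    radical_eq_self_of_prime (by norm_num), radical_eq_self_of_prime (by norm_num),
    radical_eq_self_of_prime (by norm_num), radical_eq_self_of_prime (by norm_num)]
  all_goals norm_num

/-- `rad(1·688127·688128) = 11·47·2·3·7 = 21714`. [folklore] -/
theorem rad_w6 : rad 1 688127 688128 = 21714 := by
  rw [rad_def, show (1 * 688127 * 688128 : ℕ) = (((11 ^ 4 * 47) * 2 ^ 15) * 3) * 7 by norm_num,
    radical_mul (isRelPrime_of_coprime (by norm_num)),
    radical_mul (isRelPrime_of_coprime (by norm_num)),
    radical_mul (isRelPrime_of_coprime (by norm_num)),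
    radical_mul (isRelPrime_of_coprime (by norm_num)),
    radical_pow _ (by norm_num), radical_pow _ (by norm_num),
    radical_eq_self_of_prime (by norm_num), radical_eq_self_of_prime (by norm_num),
    radical_eq_self_of_prime (by norm_num), radical_eq_self_of_prime (by norm_num),
    radical_eq_self_of_prime (by norm_num)]
  all_goals norm_num

/-- `rad(1·5764800·5764801) = 2·3·5·1201·7 = 252210`. [folklore] -/
theorem rad_w7 : rad 1 5764800 5764801 = 252210 := by
  rw [rad_def, show (1 * 5764800 * 5764801 : ℕ) = ((((2 ^ 6 * 3) * 5 ^ 2) * 1201) * 7 ^ 8) by norm_num,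
    radical_mul (isRelPrime_of_coprime (by norm_num)),
    radical_mul (isRelPrime_of_coprime (by norm_num)),
    radical_mul (isRelPrime_of_coprime (by norm_num)),
    radical_mul (isRelPrime_of_coprime (by norm_num)),
    radical_pow _ (by norm_num), radical_pow _ (by norm_num), radical_pow _ (by norm_num),
    radical_eq_self_of_prime (by norm_num), radical_eq_self_of_prime (by norm_num),
    radical_eq_self_of_prime (by norm_num), radical_eq_self_of_prime (by norm_num),
    radical_eq_self_of_prime (by norm_num)]
  all_goals norm_num

/-- `rad(1·76545000·76545001) = 2·3·5·7·13·673 = 1837290`. [folklore] -/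
theorem rad_w8 : rad 1 76545000 76545001 = 1837290 := by
  rw [rad_def,
    show (1 * 76545000 * 76545001 : ℕ) = (((((2 ^ 3 * 3 ^ 7) * 5 ^ 4) * 7) * 13 ^ 2) * 673 ^ 2)
      by norm_num,
    radical_mul (isRelPrime_of_coprime (by norm_num)),
    radical_mul (isRelPrime_of_coprime (by norm_num)),
    radical_mul (isRelPrime_of_coprime (by norm_num)),
    radical_mul (isRelPrime_of_coprime (by norm_num)),
    radical_mul (isRelPrime_of_coprime (by norm_num)),
    radical_pow _ (by norm_num), radical_pow _ (by norm_num), radical_pow _ (by norm_num),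
    radical_pow _ (by norm_num), radical_pow _ (by norm_num),
    radical_eq_self_of_prime (by norm_num), radical_eq_self_of_prime (by norm_num),
    radical_eq_self_of_prime (by norm_num), radical_eq_self_of_prime (by norm_num),
    radical_eq_self_of_prime (by norm_num), radical_eq_self_of_prime (by norm_num)]
  all_goals norm_num

/-- `rad(1·1003290624·1003290625) = 2·3·7·5·321053 = 67421130`. [folklore] -/
theorem rad_w9 : rad 1 1003290624 1003290625 = 67421130 := by
  rw [rad_def,
    show (1 * 1003290624 * 1003290625 : ℕ) = ((((2 ^ 16 * 3 ^ 7) * 7) * 5 ^ 5) * 321053) by norm_num,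
    radical_mul (isRelPrime_of_coprime (by norm_num)),
    radical_mul (isRelPrime_of_coprime (by norm_num)),
    radical_mul (isRelPrime_of_coprime (by norm_num)),
    radical_mul (isRelPrime_of_coprime (by norm_num)),
    radical_pow _ (by norm_num), radical_pow _ (by norm_num), radical_pow _ (by norm_num),
    radical_eq_self_of_prime (by norm_num), radical_eq_self_of_prime (by norm_num),
    radical_eq_self_of_prime (by norm_num), radical_eq_self_of_prime (by norm_num),
    radical_eq_self_of_prime (by norm_num)]
  all_goals norm_num

/-- `rad(1·13841287200·13841287201) = 2·3·5·13·19·43·181·7 = 403704210`. [folklore] -/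
theorem rad_w10 : rad 1 13841287200 13841287201 = 403704210 := by
  rw [rad_def,
    show (1 * 13841287200 * 13841287201 : ℕ) =
      (((((((2 ^ 5 * 3 ^ 2) * 5 ^ 2) * 13) * 19) * 43) * 181) * 7 ^ 12) by norm_num,
    radical_mul (isRelPrime_of_coprime (by norm_num)),
    radical_mul (isRelPrime_of_coprime (by norm_num)),
    radical_mul (isRelPrime_of_coprime (by norm_num)),
    radical_mul (isRelPrime_of_coprime (by norm_num)),
    radical_mul (isRelPrime_of_coprime (by norm_num)),
    radical_mul (isRelPrime_of_coprime (by norm_num)),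
    radical_mul (isRelPrime_of_coprime (by norm_num)),
    radical_pow _ (by norm_num), radical_pow _ (by norm_num), radical_pow _ (by norm_num),
    radical_pow _ (by norm_num),
    radical_eq_self_of_prime (by norm_num), radical_eq_self_of_prime (by norm_num),
    radical_eq_self_of_prime (by norm_num), radical_eq_self_of_prime (by norm_num),
    radical_eq_self_of_prime (by norm_num), radical_eq_self_of_prime (by norm_num),
    radical_eq_self_of_prime (by norm_num), radical_eq_self_of_prime (by norm_num)]
  all_goals norm_num

/-- **Every scale `30 ≤ R < 7^{12} = 13841287201` is bad at exponent `1`**: some abc triple has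
`rad ≤ R < c` (explicit covering chain of ten triples, table in the module docstring). [folklore] -/
theorem exists_triple_straddle {R : ℕ} (h30 : 30 ≤ R) (hR : R < 13841287201) :
    ∃ a b c : ℕ, IsABCTriple a b c ∧ rad a b c ≤ R ∧ R < c := by
  have T : ∀ b c : ℕ, 0 < b → 1 + b = c → IsABCTriple 1 b c :=
    fun b c hb hs => ⟨one_pos, hb, hs, Nat.coprime_one_left b⟩
  rcases Nat.lt_or_ge R 128 with h | h
  · exact ⟨3, 125, 128, ⟨by norm_num, by norm_num, by norm_num, by norm_num⟩, by rw [rad_v1]; omega, h⟩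
  rcases Nat.lt_or_ge R 243 with h | h
  · exact ⟨1, 242, 243, T _ _ (by norm_num) (by norm_num), by rw [rad_w2]; omega, h⟩
  rcases Nat.lt_or_ge R 4375 with h | h
  · exact ⟨1, 4374, 4375, T _ _ (by norm_num) (by norm_num), by rw [rad_v3]; omega, h⟩
  rcases Nat.lt_or_ge R 9801 with h | h
  · exact ⟨1, 9800, 9801, T _ _ (by norm_num) (by norm_num), by rw [rad_w4]; omega, h⟩
  rcases Nat.lt_or_ge R 59049 with h | h
  · exact ⟨1, 59048, 59049, T _ _ (by norm_num) (by norm_num), by rw [rad_w5]; omega, h⟩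
  rcases Nat.lt_or_ge R 688128 with h | h
  · exact ⟨1, 688127, 688128, T _ _ (by norm_num) (by norm_num), by rw [rad_w6]; omega, h⟩
  rcases Nat.lt_or_ge R 5764801 with h | h
  · exact ⟨1, 5764800, 5764801, T _ _ (by norm_num) (by norm_num), by rw [rad_w7]; omega, h⟩
  rcases Nat.lt_or_ge R 76545001 with h | h
  · exact ⟨1, 76545000, 76545001, T _ _ (by norm_num) (by norm_num), by rw [rad_w8]; omega, h⟩
  rcases Nat.lt_or_ge R 1003290625 with h | h
  · exact ⟨1, 1003290624, 1003290625, T _ _ (by norm_num) (by norm_num), by rw [rad_w9]; omega, h⟩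
  exact ⟨1, 13841287200, 13841287201, T _ _ (by norm_num) (by norm_num), by rw [rad_w10]; omega, hR⟩

/-- The same as a bad-scale statement in the crux's vocabulary: for `30 ≤ R < 7^{12}` the matrix of
`SparseGoodScales` fails at exponent `1 + 0`. [folklore] -/
theorem not_goodScale_zero_small {R : ℕ} (h30 : 30 ≤ R) (hR : R < 13841287201) :
    ¬ ∀ a b c : ℕ, IsABCTriple a b c → rad a b c ≤ R → (c : ℝ) ≤ (R : ℝ) ^ (1 + (0 : ℝ)) := by
  intro h
  obtain ⟨a, b, c, ht, hr, hc⟩ := exists_triple_straddle h30 hR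
  have h1 := h a b c ht hr
  rw [add_zero, Real.rpow_one] at h1
  have h2 : (R : ℝ) < c := by exact_mod_cast hc
  linarith

end Summit.ABC.ABC.Theorems.SparseGoodScales.Negative
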